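import Mathlib
import HarnessLib
import HarnessLib.Audit
import Summits.HodgeConjecture.HodgeConjecture.Theses.BoundaryReadout
import Literature.AlgebraicGeometry.HodgeTheory.HodgeTypeExteriorProduct

/-!
# Line `qbar-fibre` — ARITHMETIC ANCHORS for the crux `BoundarySupply` (stmt-HodgeConjecture-15912)

Route `BoundaryReadout` (route-HodgeConjecture-BoundaryReadout), crux of rank 2 `BoundarySupply`: every rational
`(p,p)`-class `c` on a smooth projective complex `X` is `e^*(ξ|_{X_t})` for a `ℂ`-morphism `e : X ⟶ X_t` into a
smooth projective fibre of some `f : 𝒳 ⟶ C` (`𝒳` smooth projective, `C` a smooth projective curve, `f`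
surjective) carrying a global rational `(p,p)`-class `ξ`, such that the fibre over some `o ∈ C(ℂ)` is COVERED by
finitely many smooth projective `Y_i ⟶ X_o` on which `ξ|_{Y_i}` is ABSOLUTE HODGE.

## The line (strategist, transfer lens: Deligne's proof architecture for abelian varieties)

Deligne proves "Hodge ⇒ absolute Hodge" on abelian varieties (LNM 900, Thm 2.11) in two moves: (B) PRINCIPLE B
(Thm 2.12 = Charles–Schnell Thm 11.3.7/11.3.8): absoluteness propagates along a family of Hodge classes from ONE
fibre; (A) an ANCHOR fibre where absoluteness is available for arithmetic reasons (CM points; Principle A). The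
route's engine `BoundaryAbsoluteness` is Principle B with the anchor allowed to be a covered degenerate fibre; the
crux `BoundarySupply` is the anchor-existence half, but AS TYPED it asks for the anchor pieces to carry ξ as an
ABSOLUTE class — which makes its content exactly Charles–Schnell Conj. 11.2.17 ("Hodge ⇒ absolute") for the
classes not already known absolute (route header: "trivially true where c is already known absolute").

This line transfers Deligne's cut to the crux and REMOVES ABSOLUTENESS FROM THE SUPPLY: the anchor pieces are asked
to satisfy an OBJECTIVE condition — ARITHMETIC (definable over a number field) or carrying `ξ` as a CYCLE class — and
absoluteness on them is paid by two separate statements of different kinds. Three registered stubs, composing to the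
crux BY NAME:

* `Stub.AnchorSupply : AnchorSupply` (stub 1, the hardest) — ANCHOR SUPPLY (the geometric / transcendence half): the
  crux's family block VERBATIM, with the conjunct "`ξ|_{Y_i}` absolute Hodge" replaced by "for each covering piece,
  `Y_i` is definable over a number field OR `ξ|_{Y_i} ∈ algebraicClasses (Y i) p`". No absoluteness. Anchors it
  admits: (a) a smooth ℚ̄-definable fibre (`QbarFibreAnchor` ⇒ `QbarCoveredFibre` ⇒ `AnchorSupply`, §4), which
  through the dictionary {Hodge-locus component `T_c ∋ [X]` of a ℚ̄-family (CDK: algebraic), curve in `T_c`,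
  ℚ̄-compactification + global invariant cycle lift (Voisin 2007 Lemma 2.4)} is the statement "`T_c` contains a
  ℚ̄-point" — EQUIVALENT to "`T_c` is defined over ℚ̄" by Saito–Schnell (arXiv:1408.2488, Thm 1 and Cor. 1
  (a)⇔(a')), PROVED for weakly non-factor components of positive period dimension (Klingler–Otwinowska–Urbanik 2023,
  Thm 1.12(a)) and REDUCED in general to special points (KOU Cor. 1.14); (b) a smooth fibre on which the class is a
  cycle class (`CycleFibreAnchor` ⇒ `AnchorSupply`, §4: AnchorTransport's interior algebraic anchor, consumed here
  through Principle B instead of the variational Hodge conjecture); (c) degenerate fibres whose pieces are arithmetic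
  (toric / Kulikov / LCSL boundaries) or on which `ξ` restricts to cycle classes (cellular pieces) — the route's cusp
  supply with an objective condition in place of absoluteness. Residue (honest): Hodge-locus components over
  transcendental fields with no algebraic member and no such boundary — first of all special POINTS at transcendental
  moduli, the programme's shared dark node (PeriodDeficiency.IsolatedHodgePointsQbar, FiniteTreeOfFlavours.
  RigidImpliesQbar), reached by THIS route too instead of its private "rigid classes are absolute outright".
* `Stub.AbsoluteOverNumberFields : AbsoluteOverNumberFields` (stub 2) — HODGE CLASSES ON ARITHMETIC VARIETIES ARE
  ABSOLUTE (Conj. 11.2.17 restricted to `X ≅ X₀ ⊗_{K,σ} ℂ`, `K` a number field; Deligne's Principle-A slot). Why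
  easier than 11.2.17: for `σ ∈ Aut(ℂ/K)` the conjugate variety IS `X`, so the Serre/Charles conjugate-variety
  barrier is void and absoluteness becomes ℚ̄-rationality of `(2πi)^p c` in `H_dR(X₀/K) ⊗ ℚ̄` plus a finite Galois
  check; known in abelian type (Deligne 1982, André 1996). ON THIS ROUTE IT IS FREE: `HCOverNumberFields` (crux #4,
  stmt-HodgeConjecture-1070, a hypothesis of `closes` anyway) and stub 3 give it — `absoluteOverNumberFields_of_hc`,
  sorry-free, §4. So the line's NET open content on route BoundaryReadout is `AnchorSupply` + the provable stub 3
  (§4 `example`: AnchorSupply → HCOverNumberFields → CycleClassesAbsolute → BoundarySupply).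
* `Stub.CycleClassesAbsolute : CycleClassesAbsolute` (stub 3) — CYCLE CLASSES ARE ABSOLUTE HODGE, verbatim line
  `birth`'s registered stub (syntactically the same Prop: one proof serves both lines); theorem in print
  (Charles–Schnell §11.2.2), PROVABLE NOW; it carries the conjugation-chart burden.
* `BoundarySupply_of : AnchorSupply → AbsoluteOverNumberFields → CycleClassesAbsolute → BoundarySupply` — THE
  composition, real proof: keep the family data; each `ξ|_{Y_i} = (g_i ≫ ι_o)^* ξ` is rational
  (`IsRationalClass.pullback`, PROVED) and of type `(p,p)` on the smooth projective `Y_i`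
  (`IsOfHodgeType.map_of_isSmoothProjective`, PROVED), hence absolute by stub 2 on an arithmetic piece and by stub 3
  when it is a cycle class. Every stub is used. `BoundarySupply_skeleton : BoundarySupply` instantiates it (the
  hypothesis-free registered target).

`sorry` occurs ONLY in the three stub theorems `Stub.AnchorSupply`, `Stub.AbsoluteOverNumberFields`,
`Stub.CycleClassesAbsolute` (§2 explains the naming). No stub implies the crux or the summit cheaply (seat folder
`bc/`: probes `S → BoundarySupply`, `S → HodgeConjecture` by `exact?` / `simpa` / `aesop` fail): `AnchorSupply`
supplies no absoluteness, stubs 2 and 3 supply no family.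

Disproof used: none exists for this crux (no `Cruxes/BoundarySupply/Disproof.lean`, no `_false_without_` theorem, no
landed `Theorems/BoundarySupply/Negative/*`, 2026-08-17). Nearest landed negative knowledge honoured:
`Theorems/BallQuotientHodgeAbsolute/Negative/HodgeImpliesAbsoluteHodge` (any absoluteness proof must build
conjugation charts for every σ): the chart-building burden sits entirely in stubs 2 and 3, never in the supply stub `Stub.AnchorSupply`. Negatives index (3 entries: MilnorK symbol
lift, Fermat-K3 multisets, E-line matrices): no stub is an instance.
-/

-- `Summit.<Summit>.<Problem>`: for the single-conjunct summit the duplicate `HodgeConjecture.HodgeConjecture` is mandated.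
set_option linter.dupNamespace false
set_option linter.unusedVariables false

namespace Summit.HodgeConjecture.HodgeConjecture.Cruxes.BoundarySupply.QbarFibre

open CategoryTheory

-- Statements (§1) are written FULLY QUALIFIED on purpose: a prover restates their text verbatim in a Theorems file
-- importing only the BoundaryReadout route (+ Mathlib/Literature).

/-! ## §1 The statements -/

/-- **Statement of stub 1 — anchor supply (`AnchorSupply`).** For `X` smooth projective of dimension `n` and a rational
`(p,p)`-class `c ∈ H²ᵖ(X(ℂ);ℂ)`: the crux's family block — `f : 𝒳 ⟶ C` (`𝒳` smooth projective, `C` a smooth projective curve,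
`f` surjective on points), `o t ∈ C(ℂ)`, a global rational `(p,p)`-class `ξ` on `𝒳`, a smooth projective fibre `X_t` with
`e : X ⟶ X_t` and `e^*(ξ|_{X_t}) = c`, finitely many smooth projective `Y_i ⟶ X_o` covering the fibre over `o` — with the conjunct
"`ξ|_{Y_i}` absolute Hodge" REPLACED by the OBJECTIVE anchor condition: for each piece, EITHER `Y_i` is ARITHMETIC (definable
over a number field, `Y_i ≅ Y₀ ⊗_{K,σ} ℂ`) OR `ξ|_{Y_i}` is a CYCLE class (`∈ algebraicClasses (Y i) p`). Anchors it admits: a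
smooth ℚ̄-definable fibre (`QbarFibreAnchor` ⇒ `QbarCoveredFibre` ⇒ `AnchorSupply`, §4 — fields of definition of Hodge loci:
Saito–Schnell Thm 1 / Cor. 1, KOU Thm 1.12 / Cor. 1.14); a smooth fibre on which the class is algebraic (`CycleFibreAnchor` ⇒
`AnchorSupply`, §4 — the interior algebraic anchor of AnchorTransport.AnchorExistence, here consumed through Principle B instead
of the variational Hodge conjecture); a degenerate fibre whose pieces are arithmetic (toric / Kulikov / LCSL boundaries) or on
which `ξ` restricts to cycle classes (cellular pieces: every class algebraic) — the route's cusp supply with an objective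
condition in place of absoluteness. Why plausibly true: HC-safe twice over (HC ⇒ every `ξ|_{Y_i}` is a cycle class; HC ⇒
spread cycles give ℚ̄-anchors); smooth-arithmetic case ⇔ "the Hodge-locus component through `(X,c)` is defined over ℚ̄"
(Saito–Schnell), proved in the KOU range, reduced to special points. Why it might fail: a Hodge-locus component over a
transcendental field, with no algebraic member and meeting no boundary with arithmetic / cycle-class pieces — first suspects:
isolated Hodge points at transcendental moduli (rank-2 attractor CY₃ points, so far found only at rational parameters,
arXiv:1912.06146); such a witness refutes HC too. Size: XL (open; the geometric / transcendence heart).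
[cite: SaitoSchnell2014FieldsOfDefinition, Thm 1 and Cor. 1] [cite: KlinglerOtwinowskaUrbanik2023, Thm 1.12, Cor. 1.14]
[cite: Voisin2007HodgeLoci, Lemma 2.4] [cite: Deligne1982HodgeCycles, Thm 2.12] -/
-- @[stub "qbar-fibre"]  (gate-reserved attribute, refused in crux workfiles — hence the `Stub.<Statement>` naming of §2)
def AnchorSupply : Prop :=
  ∀ ⦃n : ℕ⦄ ⦃X : Literature.AlgebraicGeometry.Motives.SchemeOver ℂ⦄,
    Literature.AlgebraicGeometry.Motives.IsSmoothProjective n X →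
    ∀ (p : ℕ) (c : Literature.AlgebraicGeometry.HodgeTheory.complexBetti X (2 * p)),
      Literature.AlgebraicGeometry.HodgeTheory.IsRationalClass c →
      Literature.AlgebraicGeometry.HodgeTheory.IsOfHodgeType n X (2 * p) p p c →
      ∃ (N : ℕ) (𝒳 C : Literature.AlgebraicGeometry.Motives.SchemeOver ℂ) (f : 𝒳 ⟶ C)
        (o t : Literature.AlgebraicGeometry.Motives.AlgPoints C ℂ) (ι : Type) (_ : Finite ι) (m : ι → ℕ)
        (Y : ι → Literature.AlgebraicGeometry.Motives.SchemeOver ℂ)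
        (g : ∀ i, Y i ⟶ Literature.AlgebraicGeometry.Motives.fiberOver f o)
        (ξ : Literature.AlgebraicGeometry.HodgeTheory.complexBetti 𝒳 (2 * p)) (n' : ℕ)
        (e : X ⟶ Literature.AlgebraicGeometry.Motives.fiberOver f t),
        Literature.AlgebraicGeometry.Motives.IsSmoothProjective N 𝒳 ∧
        Literature.AlgebraicGeometry.Motives.IsSmoothProjective 1 C ∧
        Function.Surjective f.left.base ∧
        (∀ i, Literature.AlgebraicGeometry.Motives.IsSmoothProjective (m i) (Y i)) ∧
        (∀ x : ↥(Literature.AlgebraicGeometry.Motives.fiberOver f o).left,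
          ∃ (i : ι) (y : ↥(Y i).left), (g i).left.base y = x) ∧
        Literature.AlgebraicGeometry.HodgeTheory.IsRationalClass ξ ∧
        Literature.AlgebraicGeometry.HodgeTheory.IsOfHodgeType N 𝒳 (2 * p) p p ξ ∧
        (∀ i, (∃ (K : Type) (_ : Field K) (_ : NumberField K) (σ : K →+* ℂ)
            (Y₀ : Literature.AlgebraicGeometry.Motives.SchemeOver K),
            Nonempty (Y i ≅ (Literature.AlgebraicGeometry.Motives.baseChangeHom σ).obj Y₀)) ∨
          Literature.AlgebraicGeometry.HodgeTheory.complexBetti.map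
              (CategoryTheory.CategoryStruct.comp (g i) (Literature.AlgebraicGeometry.Motives.fiberι f o)) (2 * p) ξ ∈
            Literature.AlgebraicGeometry.HodgeTheory.algebraicClasses (Y i) p) ∧
        Literature.AlgebraicGeometry.Motives.IsSmoothProjective n'
          (Literature.AlgebraicGeometry.Motives.fiberOver f t) ∧
        Literature.AlgebraicGeometry.HodgeTheory.complexBetti.map e (2 * p)
          (Literature.AlgebraicGeometry.HodgeTheory.complexBetti.map
            (Literature.AlgebraicGeometry.Motives.fiberι f t) (2 * p) ξ) = c

/-- **Auxiliary statement (not a stub) — arithmetic covered anchor (`QbarCoveredFibre`).** For `X` smooth projective of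
dimension `n` and a rational `(p,p)`-class `c ∈ H²ᵖ(X(ℂ);ℂ)`: there are `f : 𝒳 ⟶ C` (`𝒳` smooth projective, `C` a
smooth projective curve, `f` surjective on points), points `o t ∈ C(ℂ)`, a global rational `(p,p)`-class `ξ` on
`𝒳`, a smooth projective fibre `X_t` with `e : X ⟶ X_t` and `e^*(ξ|_{X_t}) = c`, and finitely many smooth
projective `Y_i ⟶ X_o` covering the fibre over `o`, EACH DEFINABLE OVER A NUMBER FIELD
(`Y_i ≅ Y₀ ⊗_{K,σ} ℂ`). This is the crux's `∃`-block with "`ξ|_{Y_i}` absolute Hodge" replaced by "`Y_i`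
arithmetic". Why plausibly true: HC-safe (HC ⇒ spread `(X, Z)` over a ℚ̄-variety, a curve through the generic
point and a ℚ̄-point, compactify, `ξ := cl(𝒵̄)`); for the smooth-anchor case it is "the Hodge-locus component
through `(X,c)` contains a ℚ̄-point" ⇔ "is defined over ℚ̄" (Saito–Schnell Thm 1, Cor. 1), proved for weakly
non-factor positive-period-dimension components (KOU Thm 1.12(a)), reduced to special points in general (KOU
Cor. 1.14); degenerate arithmetic anchors (toric / Kulikov / LCSL fibres, whose pieces are ℚ̄-definable) are the
route's boundary supply with arithmeticity in place of known type. Why it might fail: a Hodge-locus component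
defined over a transcendental field and meeting no boundary with arithmetic pieces — first suspects: isolated
Hodge points (rigid pairs) at transcendental moduli (rank-2 attractor CY threefolds, singular-K3-type phenomena
in higher level); such a witness also refutes HC. Size: XL (open; the geometric heart).
[cite: SaitoSchnell2014FieldsOfDefinition, Thm 1 and Cor. 1] [cite: KlinglerOtwinowskaUrbanik2023, Thm 1.12, Cor. 1.14]
[cite: Voisin2007HodgeLoci, Lemma 2.4] [cite: CattaniDeligneKaplan1995JAMS, Thm 1.1] -/
def QbarCoveredFibre : Prop :=
  ∀ ⦃n : ℕ⦄ ⦃X : Literature.AlgebraicGeometry.Motives.SchemeOver ℂ⦄,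
    Literature.AlgebraicGeometry.Motives.IsSmoothProjective n X →
    ∀ (p : ℕ) (c : Literature.AlgebraicGeometry.HodgeTheory.complexBetti X (2 * p)),
      Literature.AlgebraicGeometry.HodgeTheory.IsRationalClass c →
      Literature.AlgebraicGeometry.HodgeTheory.IsOfHodgeType n X (2 * p) p p c →
      ∃ (N : ℕ) (𝒳 C : Literature.AlgebraicGeometry.Motives.SchemeOver ℂ) (f : 𝒳 ⟶ C)
        (o t : Literature.AlgebraicGeometry.Motives.AlgPoints C ℂ) (ι : Type) (_ : Finite ι) (m : ι → ℕ)
        (Y : ι → Literature.AlgebraicGeometry.Motives.SchemeOver ℂ)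
        (g : ∀ i, Y i ⟶ Literature.AlgebraicGeometry.Motives.fiberOver f o)
        (ξ : Literature.AlgebraicGeometry.HodgeTheory.complexBetti 𝒳 (2 * p)) (n' : ℕ)
        (e : X ⟶ Literature.AlgebraicGeometry.Motives.fiberOver f t),
        Literature.AlgebraicGeometry.Motives.IsSmoothProjective N 𝒳 ∧
        Literature.AlgebraicGeometry.Motives.IsSmoothProjective 1 C ∧
        Function.Surjective f.left.base ∧
        (∀ i, Literature.AlgebraicGeometry.Motives.IsSmoothProjective (m i) (Y i)) ∧
        (∀ x : ↥(Literature.AlgebraicGeometry.Motives.fiberOver f o).left,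
          ∃ (i : ι) (y : ↥(Y i).left), (g i).left.base y = x) ∧
        Literature.AlgebraicGeometry.HodgeTheory.IsRationalClass ξ ∧
        Literature.AlgebraicGeometry.HodgeTheory.IsOfHodgeType N 𝒳 (2 * p) p p ξ ∧
        (∀ i, ∃ (K : Type) (_ : Field K) (_ : NumberField K) (σ : K →+* ℂ)
            (Y₀ : Literature.AlgebraicGeometry.Motives.SchemeOver K),
            Nonempty (Y i ≅ (Literature.AlgebraicGeometry.Motives.baseChangeHom σ).obj Y₀)) ∧
        Literature.AlgebraicGeometry.Motives.IsSmoothProjective n'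
          (Literature.AlgebraicGeometry.Motives.fiberOver f t) ∧
        Literature.AlgebraicGeometry.HodgeTheory.complexBetti.map e (2 * p)
          (Literature.AlgebraicGeometry.HodgeTheory.complexBetti.map
            (Literature.AlgebraicGeometry.Motives.fiberι f t) (2 * p) ξ) = c

/-- **Statement of stub 2 — Hodge classes on arithmetic varieties are absolute Hodge
(`AbsoluteOverNumberFields`).** For `X` smooth projective of dimension `n` and DEFINABLE OVER A NUMBER FIELD
(`X ≅ X₀ ⊗_{K,σ} ℂ`), every rational `(p,p)`-class on `X` is an absolute Hodge class (tree's de Rham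
`IsAbsoluteHodgeClass`). Charles–Schnell Conj. 11.2.17 restricted to arithmetic varieties — Deligne's
"Principle A" slot. Why plausibly true / easier than 11.2.17: for `σ` over `K` the conjugate variety is `X`
itself, so the statement is the ℚ̄-rationality of `(2πi)^p c` in `H_dR(X₀/K) ⊗ ℚ̄` (cf. Voisin 2007 Rmk 1.3 /
Charles–Schnell Cor. 11.3.16 for the converse bookkeeping) plus a check at the finitely many Galois conjugates
of `X₀`; known for abelian varieties and abelian-type motives (Deligne 1982 Thm 2.11, André 1996); and ON ROUTE
BoundaryReadout it is IMPLIED by crux #4 `HCOverNumberFields` + `CycleClassesAbsolute`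
(`absoluteOverNumberFields_of_hc`, §4) — not to be attacked separately there. Why it might fail: only together
with Conj. 11.2.17 / HC over ℚ̄ (a non-absolute Hodge class on a ℚ̄-variety refutes HC(ℚ̄) given cycle classes
absolute); formally it inherits the chart-building burden of `IsAbsoluteHodgeClass`. Size: XL as a theorem, zero
extra on this route. [cite: Deligne1982HodgeCycles, Thm 2.11] [cite: CharlesSchnell2014Notes, Conj. 11.2.17 and Cor. 11.3.16]
[cite: Voisin2007HodgeLoci, Prop. 1.2 and Rmk 1.3] -/
-- @[stub "qbar-fibre"]  (gate-reserved attribute, refused in crux workfiles — hence the `Stub.<Statement>` naming of §2)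
def AbsoluteOverNumberFields : Prop :=
  ∀ ⦃n : ℕ⦄ ⦃X : Literature.AlgebraicGeometry.Motives.SchemeOver ℂ⦄,
    Literature.AlgebraicGeometry.Motives.IsSmoothProjective n X →
    (∃ (K : Type) (_ : Field K) (_ : NumberField K) (σ : K →+* ℂ)
        (X₀ : Literature.AlgebraicGeometry.Motives.SchemeOver K),
        Nonempty (X ≅ (Literature.AlgebraicGeometry.Motives.baseChangeHom σ).obj X₀)) →
    ∀ (p : ℕ) (c : Literature.AlgebraicGeometry.HodgeTheory.complexBetti X (2 * p)),
      Literature.AlgebraicGeometry.HodgeTheory.IsRationalClass c →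
      Literature.AlgebraicGeometry.HodgeTheory.IsOfHodgeType n X (2 * p) p p c →
      Literature.AlgebraicGeometry.HodgeTheory.IsAbsoluteHodgeClass n X p c

/-- **Statement of stub 3 — cycle classes are absolute Hodge (`CycleClassesAbsolute`)**, VERBATIM the registered stub
statement `Birth.CycleClassesAbsolute` of line `birth` on this crux (syntactically the same Prop: ONE proof serves both
lines): a rational `(p,p)`-class in `algebraicClasses X p` is absolute Hodge. Theorem in print (Charles–Schnell §11.2.2;
Deligne 1982 Ex. 2.1(a)); formally it carries the conjugation-chart burden (landed Negative lemmas
`BallQuotientHodgeAbsolute/Negative/{HodgeImpliesAbsoluteHodge, ChartConjugationUniqueness}`). Load-bearing twice: it makes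
cycle-class anchors absolute in `BoundarySupply_of`, and with crux #4 it discharges stub 2 (§4). PROVABLE NOW (size L/XL).
[cite: CharlesSchnell2014Notes, §11.2.2 (after Def. 11.2.3)] [cite: Deligne1982HodgeCycles, Ex. 2.1(a)] -/
-- @[stub "qbar-fibre"]  (gate-reserved attribute, refused in crux workfiles — hence the `Stub.<Statement>` naming of §2)
def CycleClassesAbsolute : Prop :=
  ∀ ⦃n : ℕ⦄ ⦃X : Literature.AlgebraicGeometry.Motives.SchemeOver ℂ⦄,
    Literature.AlgebraicGeometry.Motives.IsSmoothProjective n X →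
    ∀ (p : ℕ) (c : Literature.AlgebraicGeometry.HodgeTheory.complexBetti X (2 * p)),
      Literature.AlgebraicGeometry.HodgeTheory.IsRationalClass c →
      Literature.AlgebraicGeometry.HodgeTheory.IsOfHodgeType n X (2 * p) p p c →
      c ∈ Literature.AlgebraicGeometry.HodgeTheory.algebraicClasses X p →
      Literature.AlgebraicGeometry.HodgeTheory.IsAbsoluteHodgeClass n X p c

/-- **Auxiliary statement (not a stub) — the smooth arithmetic anchor (`QbarFibreAnchor`)**, Principle-B shape:
every rational `(p,p)`-class `c` on a smooth projective `X` is `e^*(ξ|_{X_t})` for a family `f : 𝒳 ⟶ C` as in the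
crux carrying a global rational `(p,p)`-class `ξ`, some SMOOTH projective fibre `X_o` of which is definable over a
number field. The one-piece case of `QbarCoveredFibre` (`qbarCoveredFibre_of_qbarFibreAnchor`, §4) and the intended
first target of provers: through CDK + Saito–Schnell it reads "the Hodge-locus component through `(X, c)` is
defined over ℚ̄". [cite: SaitoSchnell2014FieldsOfDefinition, Thm 1 and Cor. 1] [cite: KlinglerOtwinowskaUrbanik2023, Cor. 1.14] -/
def QbarFibreAnchor : Prop :=
  ∀ ⦃n : ℕ⦄ ⦃X : Literature.AlgebraicGeometry.Motives.SchemeOver ℂ⦄,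
    Literature.AlgebraicGeometry.Motives.IsSmoothProjective n X →
    ∀ (p : ℕ) (c : Literature.AlgebraicGeometry.HodgeTheory.complexBetti X (2 * p)),
      Literature.AlgebraicGeometry.HodgeTheory.IsRationalClass c →
      Literature.AlgebraicGeometry.HodgeTheory.IsOfHodgeType n X (2 * p) p p c →
      ∃ (N : ℕ) (𝒳 C : Literature.AlgebraicGeometry.Motives.SchemeOver ℂ) (f : 𝒳 ⟶ C)
        (o t : Literature.AlgebraicGeometry.Motives.AlgPoints C ℂ) (n₀ : ℕ)
        (ξ : Literature.AlgebraicGeometry.HodgeTheory.complexBetti 𝒳 (2 * p)) (n' : ℕ)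
        (e : X ⟶ Literature.AlgebraicGeometry.Motives.fiberOver f t),
        Literature.AlgebraicGeometry.Motives.IsSmoothProjective N 𝒳 ∧
        Literature.AlgebraicGeometry.Motives.IsSmoothProjective 1 C ∧
        Function.Surjective f.left.base ∧
        Literature.AlgebraicGeometry.Motives.IsSmoothProjective n₀
          (Literature.AlgebraicGeometry.Motives.fiberOver f o) ∧
        (∃ (K : Type) (_ : Field K) (_ : NumberField K) (σ : K →+* ℂ)
            (X₀ : Literature.AlgebraicGeometry.Motives.SchemeOver K),
            Nonempty (Literature.AlgebraicGeometry.Motives.fiberOver f o ≅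
              (Literature.AlgebraicGeometry.Motives.baseChangeHom σ).obj X₀)) ∧
        Literature.AlgebraicGeometry.HodgeTheory.IsRationalClass ξ ∧
        Literature.AlgebraicGeometry.HodgeTheory.IsOfHodgeType N 𝒳 (2 * p) p p ξ ∧
        Literature.AlgebraicGeometry.Motives.IsSmoothProjective n'
          (Literature.AlgebraicGeometry.Motives.fiberOver f t) ∧
        Literature.AlgebraicGeometry.HodgeTheory.complexBetti.map e (2 * p)
          (Literature.AlgebraicGeometry.HodgeTheory.complexBetti.map
            (Literature.AlgebraicGeometry.Motives.fiberι f t) (2 * p) ξ) = c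

/-- **Auxiliary statement (not a stub) — the smooth cycle-class anchor (`CycleFibreAnchor`)**: as `QbarFibreAnchor`, but the
smooth projective anchor fibre `X_o` is asked to carry `ξ|_{X_o}` as a CYCLE class (`∈ algebraicClasses`) instead of being
arithmetic — the interior algebraic anchor of route AnchorTransport (`AnchorExistence`), consumed here through Principle B /
absoluteness rather than through the variational Hodge conjecture (`anchorSupply_of_cycleFibreAnchor`, §4).
[cite: Deligne1982HodgeCycles, Thm 2.12] [cite: CharlesSchnell2014Notes, Thm 11.3.7] -/
def CycleFibreAnchor : Prop :=
  ∀ ⦃n : ℕ⦄ ⦃X : Literature.AlgebraicGeometry.Motives.SchemeOver ℂ⦄,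
    Literature.AlgebraicGeometry.Motives.IsSmoothProjective n X →
    ∀ (p : ℕ) (c : Literature.AlgebraicGeometry.HodgeTheory.complexBetti X (2 * p)),
      Literature.AlgebraicGeometry.HodgeTheory.IsRationalClass c →
      Literature.AlgebraicGeometry.HodgeTheory.IsOfHodgeType n X (2 * p) p p c →
      ∃ (N : ℕ) (𝒳 C : Literature.AlgebraicGeometry.Motives.SchemeOver ℂ) (f : 𝒳 ⟶ C)
        (o t : Literature.AlgebraicGeometry.Motives.AlgPoints C ℂ) (n₀ : ℕ)
        (ξ : Literature.AlgebraicGeometry.HodgeTheory.complexBetti 𝒳 (2 * p)) (n' : ℕ)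
        (e : X ⟶ Literature.AlgebraicGeometry.Motives.fiberOver f t),
        Literature.AlgebraicGeometry.Motives.IsSmoothProjective N 𝒳 ∧
        Literature.AlgebraicGeometry.Motives.IsSmoothProjective 1 C ∧
        Function.Surjective f.left.base ∧
        Literature.AlgebraicGeometry.Motives.IsSmoothProjective n₀
          (Literature.AlgebraicGeometry.Motives.fiberOver f o) ∧
        Literature.AlgebraicGeometry.HodgeTheory.complexBetti.map
            (Literature.AlgebraicGeometry.Motives.fiberι f o) (2 * p) ξ ∈
          Literature.AlgebraicGeometry.HodgeTheory.algebraicClasses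
            (Literature.AlgebraicGeometry.Motives.fiberOver f o) p ∧
        Literature.AlgebraicGeometry.HodgeTheory.IsRationalClass ξ ∧
        Literature.AlgebraicGeometry.HodgeTheory.IsOfHodgeType N 𝒳 (2 * p) p p ξ ∧
        Literature.AlgebraicGeometry.Motives.IsSmoothProjective n'
          (Literature.AlgebraicGeometry.Motives.fiberOver f t) ∧
        Literature.AlgebraicGeometry.HodgeTheory.complexBetti.map e (2 * p)
          (Literature.AlgebraicGeometry.HodgeTheory.complexBetti.map
            (Literature.AlgebraicGeometry.Motives.fiberι f t) (2 * p) ξ) = c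

/-! ## §2 The three registered stubs (`sorry` lives ONLY here)

The stubs are the whole-body-`sorry` theorems `Stub.AnchorSupply`, `Stub.AbsoluteOverNumberFields`,
`Stub.CycleClassesAbsolute`, NAMED AFTER THEIR
STATEMENTS: the gate's skeleton audit admits a hypothesis of the composition theorem only if its head constant's short name is
a declared stub name (or carries a gate-stamped tag, which crux workfiles may not apply), so naming the stub theorem
`Stub.<Statement>` makes `BoundarySupply_of : AnchorSupply → AbsoluteOverNumberFields → CycleClassesAbsolute → BoundarySupply` pass BY NAME whichever
crux-concluding theorem the audit inspects first (registered stub names = statement names; a prover proves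
`theorem <Statement> : <its §1 text>` with `propose --supports stmt-HodgeConjecture-15912`). -/

/-- **Stub 1** (`Stub.AnchorSupply`) — `AnchorSupply` (statement, mechanism, risks and sources: its docstring above): anchor
supply with the objective condition "arithmetic piece ∨ cycle class on the piece", the HARDEST stub (fields of definition of
Hodge loci / geography of anchors; residue = special points). [cite: SaitoSchnell2014FieldsOfDefinition, Thm 1]
[cite: KlinglerOtwinowskaUrbanik2023, Thm 1.12] -/
theorem Stub.AnchorSupply : AnchorSupply := by
  sorry

/-- **Stub 2** (`Stub.AbsoluteOverNumberFields`) — `AbsoluteOverNumberFields` (statement, risks and sources: its docstring above): Hodge classes on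
arithmetic varieties are absolute; on route BoundaryReadout discharged by crux #4 + cycle classes absolute (§4).
[cite: Deligne1982HodgeCycles, Thm 2.11] [cite: CharlesSchnell2014Notes, Conj. 11.2.17] -/
theorem Stub.AbsoluteOverNumberFields : AbsoluteOverNumberFields := by
  sorry

/-- **Stub 3** (`Stub.CycleClassesAbsolute`) — `CycleClassesAbsolute` (statement, risks and sources: its docstring above): cycle
classes are absolute Hodge; verbatim line birth's stub 3 (one proof serves both); PROVABLE NOW.
[cite: CharlesSchnell2014Notes, §11.2.2 (after Def. 11.2.3)] [cite: Deligne1982HodgeCycles, Ex. 2.1(a)] -/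
theorem Stub.CycleClassesAbsolute : CycleClassesAbsolute := by
  sorry

/-! ## §3 The composition: the three stubs prove the crux BY NAME (sorry-free) -/

/-- **THE SKELETON THEOREM** (shape `stub₁-sig → stub₂-sig → stub₃-sig → crux`, conclusion = the route decl
`Summit.HodgeConjecture.HodgeConjecture.Theses.BoundaryReadout.BoundarySupply` BY NAME). Real proof: keep the family data of
`AnchorSupply`; for each piece, `ξ|_{Y_i} = (g_i ≫ ι_o)^* ξ` is rational (`IsRationalClass.pullback`) and of type `(p,p)` on
the smooth projective `Y_i` (`IsOfHodgeType.map_of_isSmoothProjective`); it is then absolute Hodge by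
`AbsoluteOverNumberFields` if the piece is arithmetic, and by `CycleClassesAbsolute` if the restricted class is a cycle class.
Every stub is used. [cite: Deligne1982HodgeCycles, Thm 2.12 (the Principle B architecture)] -/
theorem BoundarySupply_of :
    AnchorSupply → AbsoluteOverNumberFields → CycleClassesAbsolute →
    Summit.HodgeConjecture.HodgeConjecture.Theses.BoundaryReadout.BoundarySupply := by
  intro hS hA hZ n X hX p c hc hpp
  unfold AnchorSupply at hS
  unfold AbsoluteOverNumberFields at hA
  unfold CycleClassesAbsolute at hZ
  obtain ⟨N, 𝒳, C, f, o, t, ι, hι, m, Y, g, ξ, n', e, h𝒳, hC, hf, hY, hcov, hξr, hξh, hanch, ht, hc'⟩ :=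
    hS hX p c hc hpp
  refine ⟨N, 𝒳, C, f, o, t, ι, hι, m, Y, g, ξ, n', e, h𝒳, hC, hf, hY, hcov, hξr, hξh, fun i => ?_, ht, hc'⟩
  -- `ξ|_{Y_i}` is rational …
  have hr : Literature.AlgebraicGeometry.HodgeTheory.IsRationalClass
      (Literature.AlgebraicGeometry.HodgeTheory.complexBetti.map
        (g i ≫ Literature.AlgebraicGeometry.Motives.fiberι f o) (2 * p) ξ) :=
    hξr.pullback (Literature.AlgebraicGeometry.Motives.AlgPoints.mapContinuous (L := ℂ)
      (g i ≫ Literature.AlgebraicGeometry.Motives.fiberι f o))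
  -- … and of type `(p,p)` on the smooth projective piece `Y_i` (Voisin I §7.3.2, PROVED in the tree) …
  have hh : Literature.AlgebraicGeometry.HodgeTheory.IsOfHodgeType (m i) (Y i) (2 * p) p p
      (Literature.AlgebraicGeometry.HodgeTheory.complexBetti.map
        (g i ≫ Literature.AlgebraicGeometry.Motives.fiberι f o) (2 * p) ξ) :=
    hξh.map_of_isSmoothProjective (hY i) h𝒳 _
  -- … hence absolute Hodge: arithmetic piece, or cycle class on the piece.
  rcases hanch i with hdef | halg
  · exact hA (hY i) hdef p _ hr hh
  · exact hZ (hY i) p _ hr hh halg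

/-- **Registered target of the skeleton** — the crux BY NAME with NO hypotheses: `BoundarySupply_of` applied to the
three declared stubs (`#print axioms` reaches `sorryAx` exactly through them; closes nothing until they land).
[cite: Deligne1982HodgeCycles, Thm 2.12] -/
theorem BoundarySupply_skeleton :
    Summit.HodgeConjecture.HodgeConjecture.Theses.BoundaryReadout.BoundarySupply :=
  BoundarySupply_of Stub.AnchorSupply Stub.AbsoluteOverNumberFields Stub.CycleClassesAbsolute

/-! ## §4 Recorded relations (sorry-free): where the stubs sit -/

/-- **Stub 2 is free on route BoundaryReadout**: the route's crux #4 `HCOverNumberFields`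
(stmt-HodgeConjecture-1070, a hypothesis of `closes` in any case) together with "cycle classes are absolute
Hodge" (`CycleClassesAbsolute` = the registered stub of line `birth`, theorem in print) implies
`AbsoluteOverNumberFields`: a Hodge class on a ℚ̄-definable variety is algebraic by HC(ℚ̄), hence absolute.
[cite: CharlesSchnell2014Notes, §11.2.2] [cite: Voisin2007HodgeLoci, Prop. 1.2] -/
theorem absoluteOverNumberFields_of_hc
    (hQ : Summit.HodgeConjecture.HodgeConjecture.Theses.BoundaryReadout.HCOverNumberFields)
    (hZ : CycleClassesAbsolute) : AbsoluteOverNumberFields :=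
  fun _n _X hX hdef p c hc hpp => hZ hX p c hc hpp ((hQ hX hdef).2 p c hc hpp)

/-- The NET open content of the line on this route (an `example`, so that the hypothesis-free skeleton and
`BoundarySupply_of` are the only named theorems concluding the crux): `AnchorSupply` + the route's own crux #4 + the printed theorem "cycle classes are
absolute" give `BoundarySupply`. [cite: Voisin2007HodgeLoci, Prop. 1.2] -/
example (hS : AnchorSupply)
    (hQ : Summit.HodgeConjecture.HodgeConjecture.Theses.BoundaryReadout.HCOverNumberFields)
    (hZ : CycleClassesAbsolute) :
    Summit.HodgeConjecture.HodgeConjecture.Theses.BoundaryReadout.BoundarySupply :=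
  BoundarySupply_of hS (absoluteOverNumberFields_of_hc hQ hZ) hZ

/-- Arithmetic covered anchors are anchors (left alternative piecewise). [folklore] -/
theorem anchorSupply_of_qbarCoveredFibre (h : QbarCoveredFibre) : AnchorSupply := by
  intro n X hX p c hc hpp
  obtain ⟨N, 𝒳, C, f, o, t, ι, hι, m, Y, g, ξ, n', e, h𝒳, hC, hf, hY, hcov, hξr, hξh, hdef, ht, hc'⟩ := h hX p c hc hpp
  exact ⟨N, 𝒳, C, f, o, t, ι, hι, m, Y, g, ξ, n', e, h𝒳, hC, hf, hY, hcov, hξr, hξh, fun i => Or.inl (hdef i), ht, hc'⟩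

/-- **The smooth cycle-class anchor suffices** (one piece `Y = X_o`, `g = 𝟙`; AnchorTransport's interior anchor read through
absoluteness): `CycleFibreAnchor` implies `AnchorSupply`. [cite: Deligne1982HodgeCycles, Thm 2.12] -/
theorem anchorSupply_of_cycleFibreAnchor (h : CycleFibreAnchor) : AnchorSupply := by
  intro n X hX p c hc hpp
  obtain ⟨N, 𝒳, C, f, o, t, n₀, ξ, n', e, h𝒳, hC, hf, ho, halg, hξr, hξh, ht, hc'⟩ := h hX p c hc hpp
  refine ⟨N, 𝒳, C, f, o, t, Unit, inferInstance, fun _ => n₀,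
    fun _ => Literature.AlgebraicGeometry.Motives.fiberOver f o, fun _ => 𝟙 _, ξ, n', e,
    h𝒳, hC, hf, fun _ => ho, fun x => ⟨(), x, rfl⟩, hξr, hξh, fun _ => Or.inr ?_, ht, hc'⟩
  simpa using halg

/-- **The smooth arithmetic anchor suffices** (Principle-B shape, one piece `Y = X_o`, `g = 𝟙`): `QbarFibreAnchor`
implies `QbarCoveredFibre`. This is the case provers should aim at first; degenerate arithmetic anchors are the
extra room the covered form leaves. [cite: Deligne1982HodgeCycles, Thm 2.12] -/
theorem qbarCoveredFibre_of_qbarFibreAnchor (h : QbarFibreAnchor) : QbarCoveredFibre := by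
  intro n X hX p c hc hpp
  obtain ⟨N, 𝒳, C, f, o, t, n₀, ξ, n', e, h𝒳, hC, hf, ho, hdef, hξr, hξh, ht, hc'⟩ := h hX p c hc hpp
  refine ⟨N, 𝒳, C, f, o, t, Unit, inferInstance, fun _ => n₀,
    fun _ => Literature.AlgebraicGeometry.Motives.fiberOver f o, fun _ => 𝟙 _, ξ, n', e,
    h𝒳, hC, hf, fun _ => ho, fun x => ⟨(), x, ?_⟩, hξr, hξh, fun _ => hdef, ht, hc'⟩
  rfl

end Summit.HodgeConjecture.HodgeConjecture.Cruxes.BoundarySupply.QbarFibre
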